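import Literature.NumberTheory.Rogawski1990.IsQuotientOfTransport          -- ★ `OrbitalMeasureFamily.IsQuotientOf.transport` (+ `transportEquiv`, `preClass`, `transportConj_spec`, ★ `OrbitalMeasureFamily.transport`)
import Literature.NumberTheory.Automorphic.OrbitalMeasureQuotientOfPoint    -- ★ `OrbitalMeasureFamily.IsQuotientOf.atPoint_eq_quotientMeasure_of_forall_map_conj_eq`, `continuous_mulAutConj`
import Literature.NumberTheory.Automorphic.UnitaryGroupOrbitalMeasureOfLocalQuotient  -- ★ `isHaarMeasure_map_subgroupCongrHomeomorph`, `isInvInvariant_map_subgroupCongrHomeomorph`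
import HarnessLib

/-!
# The orbital measure family OF a torus datum (`m c := dν ∕ dT_{out c}` on the `P`-classes, `0` elsewhere), and the PULL-BACK of a conjugation-coherent
# torus datum along a bicontinuous isomorphism `ψ : B ≃* A` (Rogawski 1990 §1.7 «compatible measures», §4.3 (4.3.1); Deitmar–Echterhoff Thm. 1.5.3)

Topic `NumberTheory/Automorphic`; namespace `Literature.NumberTheory.Automorphic` (generic, any locally compact second countable Hausdorff group).  THEOREMS ONLY
(no `def`, no instance, no notation, no axiom, no named fact, no `sorry`).  Cell `pub/hodgecm-mathlib`, ENGINE T1 (crux H413 = `stmt-HodgeConjecture-24833`); the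
(ST-∞) witness road, brick (W4a) «THE FAMILY OF A TORUS DATUM ∕ PULL-BACK OF A COHERENT DATUM» (F0P3a-p07 (g9), LEAD F0P3a-plan (g10) lane T9-8 (G); feeds (W4b) «the arch singular
witness on `U(H′)(L⊗ℝ)`» and ★ p843392's `hpinα∕hpinβ` via (W3) §3∕§4 of F0P3-p03 (g10)).  Count-neutral plumbing; HONEST LABEL: HC_CM is proved only modulo the printed citations
until rung 0 closes; nothing here bears on a summit statement.

WHAT.
* §1 **`exists_orbitalMeasureFamily_isQuotientOf`** — given a predicate `P` on `G`, a two-sided Haar measure `ν` on `G` and a torus datum `T : ∀ γ, Measure Z(γ)` that is Haar and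
  inversion-invariant at the `P`-points, THERE IS a class-indexed family `m` with `m.IsQuotientOf P ν T` (★), `G`-invariant at EVERY class and `0` off the `P`-classes
  (the classwise definition «`dν ∕ dT_{out c}` if `P (out c)`, else `0`», done once for every carrier); `IsQuotientOf.of_imp_of_eq` (sub-predicate, agreeing datum).
* §2 bookkeeping: transport of a measure along `Z(γ₁) ≃ₜ Z(γ₂) ≃ₜ Z(γ₃)` (restrictions of `e₁ : G₁ ≃* G₂`, `e₂ : G₂ ≃* G₃`) is transport along the restriction of any `e₃` agreeing
  with `e₂ ∘ e₁` pointwise (`map_subgroupCongrHomeomorph_map_subgroupCongrHomeomorph`), and depends on `e` only through its values (`map_subgroupCongrHomeomorph_congr`).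
* §3 the PULL-BACK `b ↦ (ψ⁻¹|_{Z(ψ b)})_* T (ψ b)` of a torus datum `T` on `A` along a bicontinuous `ψ : B ≃* A` (written as a term, no definition): it is Haar ∕ inversion-
  invariant where `T` is; it is conjugation-COHERENT on `P ∘ ψ` when `T` is coherent on a conjugation-stable `P` (`map_conj_pullback_eq_pullback`); and it satisfies the
  representative condition `ht` of ★ `OrbitalMeasureFamily.IsQuotientOf.transport` with target datum `T` itself (`eq_map_transportEquiv_pullback`).
* §4 **`OrbitalMeasureFamily.IsQuotientOf.transport_of_pullback`**: if `m′` on `B` is the Weil quotient of `ν′` by the pulled-back datum on the `(P ∘ ψ)`-classes, then `ψ_* m′` is the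
  Weil quotient of `ψ_* ν′` by `T` on the `P`-classes; **`….atPoint_transport_eq_quotientMeasure_of_pullback`**: hence `(ψ_* m′).atPoint a = d(ψ_* ν′) ∕ dT_a` AT EVERY `P`-point `a`
  (★ `IsQuotientOf.atPoint_eq_quotientMeasure_of_forall_map_conj_eq`) — the `hq` of ★ (D5)∕★ p843392 for a family built on the inner form `G′_∞` and read on the diagonal carrier.

## References
* [Rogawski1990] J. D. Rogawski, *Automorphic Representations of Unitary Groups in Three Variables*, Ann. of Math. Stud. 123 (1990), §1.7 p. 6; §4.3 (4.3.1) p. 43; §8.2 pp. 122–124.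
* [DeitmarEchterhoff2014] A. Deitmar, S. Echterhoff, *Principles of Harmonic Analysis*, 2nd ed. (2014), Thm. 1.5.3 (invariant quotient measure; uniqueness).
* [Gelbart1975] S. Gelbart, *Automorphic Forms on Adele Groups* (1975), §10 pp. 154–155 (transport of orbital measures along an isomorphism).
-/

set_option autoImplicit false

noncomputable section

open MeasureTheory Measure Set
open Literature.MeasureTheory.Group Literature.NumberTheory.Rogawski1990

namespace Literature.NumberTheory.Automorphic

/-! ## §1 The family of a torus datum -/

section OfDatum

variable {G : Type*} [Group G] [TopologicalSpace G] [IsTopologicalGroup G] [LocallyCompactSpace G] [SecondCountableTopology G]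
  [T2Space G] [MeasurableSpace G] [BorelSpace G]
  [∀ γ : G, MeasurableSpace (G ⧸ Subgroup.centralizer ({γ} : Set G))] [∀ γ : G, BorelSpace (G ⧸ Subgroup.centralizer ({γ} : Set G))]

/-- **THE FAMILY OF A TORUS DATUM EXISTS.**  For a torus datum `T` Haar and inversion-invariant at the `P`-points there is a class-indexed orbital measure family `m` which IS the
Weil quotient of `ν` by `T` on the `P`-classes (★ `OrbitalMeasureFamily.IsQuotientOf P ν T m`), is `G`-invariant at every class, and vanishes off the `P`-classes — namely
`m c := dν ∕ dT_{out c}` if `P (out c)`, else `0` («the orbital integrals are defined using compatible measures», the Weil quotient being the compatible one).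
[cite: Rogawski1990, §1.7 p. 6; §4.3 (4.3.1) p. 43] [cite: DeitmarEchterhoff2014, Thm. 1.5.3] -/
theorem exists_orbitalMeasureFamily_isQuotientOf (P : G → Prop) (ν : Measure G) [ν.IsHaarMeasure] [ν.IsMulRightInvariant]
    (T : ∀ γ : G, Measure (Subgroup.centralizer ({γ} : Set G))) (hT : ∀ γ, P γ → (T γ).IsHaarMeasure ∧ (T γ).IsInvInvariant) :
    ∃ m : OrbitalMeasureFamily G, m.IsQuotientOf P ν T ∧
      (∀ c : ConjClasses G, SMulInvariantMeasure G (G ⧸ Subgroup.centralizer ({(Quotient.out c : G)} : Set G)) (m c)) ∧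
      (∀ c : ConjClasses G, ¬ P (Quotient.out c) → m c = 0) := by
  classical
  refine ⟨fun c => if h : P (Quotient.out c) then
      (haveI := (hT _ h).1
       haveI := (hT _ h).2
       quotientMeasure (Subgroup.centralizer ({(Quotient.out c : G)} : Set G)) (T (Quotient.out c)) (isClosed_coe_centralizer_singleton _) ν)
    else 0, fun c hc => ?_, fun c => ?_, fun c hc => ?_⟩
  · refine ⟨(hT _ hc).1, (hT _ hc).2, ?_⟩
    simp only [dif_pos hc]
  · by_cases hc : P (Quotient.out c)
    · simp only [dif_pos hc]
      haveI := (hT _ hc).1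
      haveI := (hT _ hc).2
      exact smulInvariantMeasure_quotientMeasure _ _ _ _
    · simp only [dif_neg hc]
      infer_instance
  · simp only [dif_neg hc]

/-- **Weil form on a sub-predicate with an agreeing datum**: `m.IsQuotientOf P ν t`, `Q ⇒ P` at the representatives, and `t′ = t` at the `Q`-representatives give
`m.IsQuotientOf Q ν t′` (★ `IsQuotientOf` reads the datum at the representatives of the guarded classes only). [cite: Rogawski1990, §4.3 (4.3.1) p. 43] -/
theorem OrbitalMeasureFamily.IsQuotientOf.of_imp_of_eq {P Q : G → Prop} {ν : Measure G} [IsFiniteMeasureOnCompacts ν] [ν.IsMulRightInvariant]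
    {t t' : ∀ γ : G, Measure (Subgroup.centralizer ({γ} : Set G))} {m : OrbitalMeasureFamily G} (h : m.IsQuotientOf P ν t)
    (hQP : ∀ c : ConjClasses G, Q (Quotient.out c) → P (Quotient.out c)) (htt' : ∀ c : ConjClasses G, Q (Quotient.out c) → t' (Quotient.out c) = t (Quotient.out c)) :
    m.IsQuotientOf Q ν t' := by
  intro c hc
  obtain ⟨h1, h2, h3⟩ := h c (hQP c hc)
  have he := htt' c hc
  haveI i1 : (t' (Quotient.out c)).IsHaarMeasure := by rw [he]; exact h1
  haveI i2 : (t' (Quotient.out c)).IsInvInvariant := by rw [he]; exact h2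
  refine ⟨i1, i2, ?_⟩
  rw [h3]
  -- the quotient measure depends on the measure only (Prop-valued instances)
  have key : ∀ (ρ : Measure (Subgroup.centralizer ({(Quotient.out c : G)} : Set G))) (_ : ρ.IsHaarMeasure) (_ : ρ.IsInvInvariant),
      ρ = t (Quotient.out c) →
        quotientMeasure (Subgroup.centralizer ({(Quotient.out c : G)} : Set G)) (t (Quotient.out c)) (isClosed_coe_centralizer_singleton _) ν =
          quotientMeasure (Subgroup.centralizer ({(Quotient.out c : G)} : Set G)) ρ (isClosed_coe_centralizer_singleton _) ν := by
    intro ρ _ _ hρ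
    subst hρ
    rfl
  exact key _ i1 i2 he

end OfDatum

/-! ## §2 Bookkeeping: composing and comparing transports along restrictions of isomorphisms -/

section Congr

variable {G₁ G₂ G₃ : Type*} [Group G₁] [Group G₂] [Group G₃] [TopologicalSpace G₁] [TopologicalSpace G₂] [TopologicalSpace G₃]
  [MeasurableSpace G₁] [BorelSpace G₁] [MeasurableSpace G₂] [BorelSpace G₂] [MeasurableSpace G₃] [BorelSpace G₃]

/-- **Transport along `e₁|` then `e₂|` is transport along `e₃|` whenever `e₂ (e₁ x) = e₃ x` for all `x`** (restrictions `H₁ ≃ₜ H₂ ≃ₜ H₃` of group isomorphisms; Mathlib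
`Measure.map_map` and extensionality on the subtype). [cite: DeitmarEchterhoff2014, Thm. 1.5.3] -/
theorem map_subgroupCongrHomeomorph_map_subgroupCongrHomeomorph (e₁ : G₁ ≃* G₂) (e₂ : G₂ ≃* G₃) (e₃ : G₁ ≃* G₃) (he : ∀ x, e₂ (e₁ x) = e₃ x)
    (H₁ : Subgroup G₁) (H₂ : Subgroup G₂) (H₃ : Subgroup G₃)
    (h₁₂ : ∀ g, e₁ g ∈ H₂ ↔ g ∈ H₁) (h₂₃ : ∀ g, e₂ g ∈ H₃ ↔ g ∈ H₂) (h₁₃ : ∀ g, e₃ g ∈ H₃ ↔ g ∈ H₁)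
    (c₁ : Continuous e₁) (c₁' : Continuous e₁.symm) (c₂ : Continuous e₂) (c₂' : Continuous e₂.symm) (c₃ : Continuous e₃) (c₃' : Continuous e₃.symm)
    (μ : Measure H₁) :
    (μ.map (subgroupCongrHomeomorph e₁ H₁ H₂ h₁₂ c₁ c₁')).map (subgroupCongrHomeomorph e₂ H₂ H₃ h₂₃ c₂ c₂') =
      μ.map (subgroupCongrHomeomorph e₃ H₁ H₃ h₁₃ c₃ c₃') := by
  rw [Measure.map_map (subgroupCongrHomeomorph e₂ H₂ H₃ h₂₃ c₂ c₂').continuous.measurable (subgroupCongrHomeomorph e₁ H₁ H₂ h₁₂ c₁ c₁').continuous.measurable]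
  congr 1
  funext x
  apply Subtype.ext
  simp only [Function.comp_apply, coe_subgroupCongrHomeomorph_apply, he]

omit [BorelSpace G₁] [BorelSpace G₂] in
/-- **Transport along `e|` depends on `e` only through its values**: `e x = e′ x` for all `x` gives the same transported measure. [cite: DeitmarEchterhoff2014, Thm. 1.5.3] -/
theorem map_subgroupCongrHomeomorph_congr (e e' : G₁ ≃* G₂) (he : ∀ x, e x = e' x) (H₁ : Subgroup G₁) (H₂ : Subgroup G₂)
    (h : ∀ g, e g ∈ H₂ ↔ g ∈ H₁) (h' : ∀ g, e' g ∈ H₂ ↔ g ∈ H₁)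
    (c : Continuous e) (c' : Continuous e.symm) (d : Continuous e') (d' : Continuous e'.symm) (μ : Measure H₁) :
    μ.map (subgroupCongrHomeomorph e H₁ H₂ h c c') = μ.map (subgroupCongrHomeomorph e' H₁ H₂ h' d d') := by
  congr 1
  funext x
  apply Subtype.ext
  simp only [coe_subgroupCongrHomeomorph_apply, he]

end Congr

/-! ## §3 The pull-back of a torus datum along a bicontinuous isomorphism `ψ : B ≃* A` -/

section Pullback

variable {A B : Type*} [Group A] [Group B] [TopologicalSpace A] [TopologicalSpace B]
  [IsTopologicalGroup A] [IsTopologicalGroup B] [MeasurableSpace A] [BorelSpace A] [MeasurableSpace B] [BorelSpace B]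
  (ψ : B ≃* A) (hψ : Continuous ψ) (hψs : Continuous ψ.symm)
  (T : ∀ a : A, Measure (Subgroup.centralizer ({a} : Set A)))

/-- **The pull-back `(ψ⁻¹|_{Z(ψ b)})_* T (ψ b)` is a Haar measure where `T` is** (★ `isHaarMeasure_map_subgroupCongrHomeomorph`). [cite: Rogawski1990, §1.7 p. 6] -/
theorem isHaarMeasure_pullback [LocallyCompactSpace A] [T2Space A] (b : B) [(T (ψ b)).IsHaarMeasure] :
    ((T (ψ b)).map (subgroupCongrHomeomorph ψ.symm (Subgroup.centralizer ({ψ b} : Set A)) (Subgroup.centralizer ({b} : Set B))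
      (forall_apply_mem_centralizer_singleton_iff_of_eq ψ.symm (ψ.symm_apply_apply b)) hψs hψ)).IsHaarMeasure :=
  haveI : LocallyCompactSpace (Subgroup.centralizer ({ψ b} : Set A)) := (isClosed_coe_centralizer_singleton (ψ b)).isClosedEmbedding_subtypeVal.locallyCompactSpace
  isHaarMeasure_map_subgroupCongrHomeomorph _ _ _ _ _ _ _

/-- **The pull-back is inversion-invariant where `T` is** (★ `isInvInvariant_map_subgroupCongrHomeomorph`). [cite: Rogawski1990, §1.7 p. 6] -/
theorem isInvInvariant_pullback (b : B) [(T (ψ b)).IsInvInvariant] :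
    ((T (ψ b)).map (subgroupCongrHomeomorph ψ.symm (Subgroup.centralizer ({ψ b} : Set A)) (Subgroup.centralizer ({b} : Set B))
      (forall_apply_mem_centralizer_singleton_iff_of_eq ψ.symm (ψ.symm_apply_apply b)) hψs hψ)).IsInvInvariant :=
  isInvInvariant_map_subgroupCongrHomeomorph _ _ _ _ _ _ _

variable {P : A → Prop}
  (hcoh : ∀ (a₁ a₂ q : A) (hq : (MulAut.conj q : A ≃* A) a₁ = a₂), P a₁ →
    Measure.map (subgroupCongrHomeomorph (MulAut.conj q : A ≃* A) (Subgroup.centralizer ({a₁} : Set A)) (Subgroup.centralizer ({a₂} : Set A))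
      (forall_apply_mem_centralizer_singleton_iff_of_eq (MulAut.conj q : A ≃* A) hq) (continuous_mulAutConj q) (continuous_mulAutConj_symm q)) (T a₁) = T a₂)

include hcoh in
/-- **THE PULL-BACK OF A COHERENT DATUM IS COHERENT**: if `T` is conjugation-coherent on the `P`-points of `A` (the `hcoh` of ★ `IsQuotientOf.atPoint_eq_quotientMeasure_of_forall_map_conj_eq`),
then `b ↦ (ψ⁻¹|)_* T (ψ b)` is conjugation-coherent on the `(P ∘ ψ)`-points of `B`: a conjugator `r ∈ B` acts through `ψ r ∈ A`, and `ψ⁻¹ ∘ conj(ψ r) = conj(r) ∘ ψ⁻¹` (§2).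
[cite: Rogawski1990, §1.7 p. 6; §4.3 (4.3.1) p. 43] [cite: DeitmarEchterhoff2014, Thm. 1.5.3] -/
theorem map_conj_pullback_eq_pullback (b₁ b₂ r : B) (hr : (MulAut.conj r : B ≃* B) b₁ = b₂) (hb : P (ψ b₁)) :
    Measure.map (subgroupCongrHomeomorph (MulAut.conj r : B ≃* B) (Subgroup.centralizer ({b₁} : Set B)) (Subgroup.centralizer ({b₂} : Set B))
        (forall_apply_mem_centralizer_singleton_iff_of_eq (MulAut.conj r : B ≃* B) hr) (continuous_mulAutConj r) (continuous_mulAutConj_symm r))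
      ((T (ψ b₁)).map (subgroupCongrHomeomorph ψ.symm (Subgroup.centralizer ({ψ b₁} : Set A)) (Subgroup.centralizer ({b₁} : Set B))
        (forall_apply_mem_centralizer_singleton_iff_of_eq ψ.symm (ψ.symm_apply_apply b₁)) hψs hψ)) =
      (T (ψ b₂)).map (subgroupCongrHomeomorph ψ.symm (Subgroup.centralizer ({ψ b₂} : Set A)) (Subgroup.centralizer ({b₂} : Set B))
        (forall_apply_mem_centralizer_singleton_iff_of_eq ψ.symm (ψ.symm_apply_apply b₂)) hψs hψ) := by
  -- the conjugator `ψ r` relates `ψ b₁` and `ψ b₂` in `A`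
  have hq : (MulAut.conj (ψ r) : A ≃* A) (ψ b₁) = ψ b₂ := by
    rw [← hr, MulAut.conj_apply, MulAut.conj_apply, map_mul, map_mul, map_inv]
  -- the common isomorphism `e₃ = conj r ∘ ψ⁻¹ : A ≃* B`, `e₃ (ψ b₁) = b₂`
  have he₃ : (ψ.symm.trans (MulAut.conj r : B ≃* B)) (ψ b₁) = b₂ := by
    rw [MulEquiv.trans_apply, MulEquiv.symm_apply_apply]; exact hr
  have c₃ : Continuous (ψ.symm.trans (MulAut.conj r : B ≃* B)) := (continuous_mulAutConj r).comp hψs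
  have c₃' : Continuous (ψ.symm.trans (MulAut.conj r : B ≃* B)).symm := by
    change Continuous (fun x => ψ.symm.symm ((MulAut.conj r : B ≃* B).symm x))
    exact hψ.comp (continuous_mulAutConj_symm r)
  rw [map_subgroupCongrHomeomorph_map_subgroupCongrHomeomorph ψ.symm (MulAut.conj r : B ≃* B) (ψ.symm.trans (MulAut.conj r : B ≃* B)) (fun x => rfl)
      _ _ _ _ _ (forall_apply_mem_centralizer_singleton_iff_of_eq _ he₃) hψs hψ _ _ c₃ c₃',
    ← hcoh (ψ b₁) (ψ b₂) (ψ r) hq hb,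
    map_subgroupCongrHomeomorph_map_subgroupCongrHomeomorph (MulAut.conj (ψ r) : A ≃* A) ψ.symm (ψ.symm.trans (MulAut.conj r : B ≃* B)) (fun x => ?_)
      _ _ _ _ _ (forall_apply_mem_centralizer_singleton_iff_of_eq _ he₃) _ _ hψs hψ c₃ c₃']
  simp only [MulEquiv.trans_apply, MulAut.conj_apply, map_mul, map_inv, MulEquiv.symm_apply_apply]

omit [IsTopologicalGroup B] in
include hcoh in
/-- **THE REPRESENTATIVE CONDITION `ht` OF ★ `IsQuotientOf.transport` FOR THE PULL-BACK**, with target datum `T` itself: at a class `c` of `A` with `P (out c)` and `P` conjugation-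
stable, `T (out c) = (e_c|_Z)_* ((ψ⁻¹|)_* T (ψ (out (ψ⁻¹ c))))`, `e_c = conj(x_c) ∘ ψ` (★ `transportEquiv`): `e_c ∘ ψ⁻¹ = conj(x_c)` and `x_c · ψ(out (ψ⁻¹ c)) · x_c⁻¹ = out c`
(★ `transportConj_spec`), so this is coherence of `T` along `x_c`. [cite: Rogawski1990, §4.3 (4.3.1) p. 43] [cite: Gelbart1975, §10 pp. 154–155] -/
theorem eq_map_transportEquiv_pullback (hP : ∀ (a q : A), P a → P (q * a * q⁻¹))
    [∀ a : A, MeasurableSpace (A ⧸ Subgroup.centralizer ({a} : Set A))] [∀ a : A, BorelSpace (A ⧸ Subgroup.centralizer ({a} : Set A))]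
    [∀ b : B, MeasurableSpace (B ⧸ Subgroup.centralizer ({b} : Set B))] [∀ b : B, BorelSpace (B ⧸ Subgroup.centralizer ({b} : Set B))]
    (c : ConjClasses A) (hc : P (Quotient.out c)) :
    T (Quotient.out c) = Measure.map (subgroupCongrHomeomorph (transportEquiv ψ c)
        (Subgroup.centralizer ({(Quotient.out (preClass ψ c) : B)} : Set B)) (Subgroup.centralizer ({(Quotient.out c : A)} : Set A))
        (forall_apply_mem_centralizer_singleton_iff_of_eq (transportEquiv ψ c) (transportEquiv_out ψ c))
        (continuous_transportEquiv ψ hψ c) (continuous_transportEquiv_symm ψ hψs c))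
      ((T (ψ (Quotient.out (preClass ψ c)))).map (subgroupCongrHomeomorph ψ.symm (Subgroup.centralizer ({ψ (Quotient.out (preClass ψ c))} : Set A))
        (Subgroup.centralizer ({(Quotient.out (preClass ψ c) : B)} : Set B))
        (forall_apply_mem_centralizer_singleton_iff_of_eq ψ.symm (ψ.symm_apply_apply _)) hψs hψ)) := by
  -- `x_c` conjugates `ψ (out (ψ⁻¹ c))` to `out c`; `P` there by conjugation-stability
  have hx : (MulAut.conj (transportConj ψ c) : A ≃* A) (ψ (Quotient.out (preClass ψ c))) = Quotient.out c := transportConj_spec ψ c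
  have hPpre : P (ψ (Quotient.out (preClass ψ c))) := by
    have h1 : ψ (Quotient.out (preClass ψ c)) = (transportConj ψ c)⁻¹ * Quotient.out c * (transportConj ψ c)⁻¹⁻¹ := by
      rw [inv_inv, ← hx, MulAut.conj_apply]; group
    rw [h1]; exact hP _ _ hc
  rw [map_subgroupCongrHomeomorph_map_subgroupCongrHomeomorph ψ.symm (transportEquiv ψ c) (MulAut.conj (transportConj ψ c) : A ≃* A) (fun x => ?_)
      _ _ _ _ _ (forall_apply_mem_centralizer_singleton_iff_of_eq _ hx) hψs hψ _ _ (continuous_mulAutConj _) (continuous_mulAutConj_symm _),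
    hcoh _ _ _ hx hPpre]
  rw [transportEquiv_apply, MulEquiv.apply_symm_apply, MulAut.conj_apply]

end Pullback

/-! ## §4 `ψ_* m′` for a family `m′` in Weil form for the pulled-back datum: Weil form for `T`, read AT every `P`-point -/

section TransportPullback

variable {A B : Type*} [Group A] [Group B] [TopologicalSpace A] [TopologicalSpace B]
  [IsTopologicalGroup A] [IsTopologicalGroup B] [LocallyCompactSpace A] [LocallyCompactSpace B]
  [SecondCountableTopology A] [SecondCountableTopology B] [T2Space A] [T2Space B]
  [MeasurableSpace A] [BorelSpace A] [MeasurableSpace B] [BorelSpace B]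
  [∀ a : A, MeasurableSpace (A ⧸ Subgroup.centralizer ({a} : Set A))] [∀ a : A, BorelSpace (A ⧸ Subgroup.centralizer ({a} : Set A))]
  [∀ b : B, MeasurableSpace (B ⧸ Subgroup.centralizer ({b} : Set B))] [∀ b : B, BorelSpace (B ⧸ Subgroup.centralizer ({b} : Set B))]
  (ψ : B ≃* A) (hψ : Continuous ψ) (hψs : Continuous ψ.symm)
  {P : A → Prop} (hP : ∀ (a q : A), P a → P (q * a * q⁻¹))
  (ν' : Measure B) [ν'.IsHaarMeasure] [ν'.IsMulRightInvariant] (ν : Measure A) [ν.IsHaarMeasure] [ν.IsMulRightInvariant] (hν : ν = Measure.map ψ ν')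
  (T : ∀ a : A, Measure (Subgroup.centralizer ({a} : Set A)))
  (hcoh : ∀ (a₁ a₂ q : A) (hq : (MulAut.conj q : A ≃* A) a₁ = a₂), P a₁ →
    Measure.map (subgroupCongrHomeomorph (MulAut.conj q : A ≃* A) (Subgroup.centralizer ({a₁} : Set A)) (Subgroup.centralizer ({a₂} : Set A))
      (forall_apply_mem_centralizer_singleton_iff_of_eq (MulAut.conj q : A ≃* A) hq) (continuous_mulAutConj q) (continuous_mulAutConj_symm q)) (T a₁) = T a₂)
  {m' : OrbitalMeasureFamily B}
  (hm' : m'.IsQuotientOf (fun b => P (ψ b)) ν' fun b => (T (ψ b)).map (subgroupCongrHomeomorph ψ.symm (Subgroup.centralizer ({ψ b} : Set A)) (Subgroup.centralizer ({b} : Set B))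
      (forall_apply_mem_centralizer_singleton_iff_of_eq ψ.symm (ψ.symm_apply_apply b)) hψs hψ))

include hP hν hcoh hm' in
/-- **`ψ_* m′` IS THE WEIL QUOTIENT OF `ψ_* ν′` BY `T` ON THE `P`-CLASSES**, for `m′` the Weil quotient of `ν′` by the pulled-back datum on the `(P ∘ ψ)`-classes (★ `IsQuotientOf.transport`,
its `ht` by §3 `eq_map_transportEquiv_pullback`; `P (out c) ⇒ P (ψ (out (ψ⁻¹ c)))` as these are conjugate). [cite: Rogawski1990, §1.7 p. 6; §4.3 (4.3.1) p. 43] [cite: DeitmarEchterhoff2014, Thm. 1.5.3] -/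
theorem OrbitalMeasureFamily.IsQuotientOf.transport_of_pullback : (m'.transport ψ hψ hψs).IsQuotientOf P ν T := by
  refine hm'.transport ψ hψ hψs ν' _ ν hν (fun c hc => ?_) T (fun c hc => eq_map_transportEquiv_pullback ψ hψ hψs T hcoh hP c hc)
  have hx := transportConj_spec ψ c
  have h1 : ψ (Quotient.out (preClass ψ c)) = (transportConj ψ c)⁻¹ * Quotient.out c * (transportConj ψ c)⁻¹⁻¹ := by
    rw [inv_inv, ← hx]; group
  show P (ψ (Quotient.out (preClass ψ c)))
  rw [h1]; exact hP _ _ hc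

include hP hν hcoh hm' in
/-- **`(ψ_* m′).atPoint a = d(ψ_* ν′) ∕ dT_a` AT EVERY `P`-POINT `a`** — the Weil form of the transported family read at the point itself (★ `IsQuotientOf.atPoint_eq_quotientMeasure_of_forall_map_conj_eq`
over §4's `transport_of_pullback`): the `hq` of ★ (D5) ∕ ★ `archStableOrbitalIntegral_signed_eq_of_isArchInnerTransfer_of_pinned` for a family built on the source carrier.
[cite: Rogawski1990, §1.7 p. 6; §4.3 (4.3.1) p. 43; §8.2 pp. 122–124] [cite: DeitmarEchterhoff2014, Thm. 1.5.3] -/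
theorem OrbitalMeasureFamily.IsQuotientOf.atPoint_transport_eq_quotientMeasure_of_pullback (a : A) (ha : P a) :
    ∃ (_ : (T a).IsHaarMeasure) (_ : (T a).IsInvInvariant),
      (m'.transport ψ hψ hψs).atPoint a = quotientMeasure (Subgroup.centralizer ({a} : Set A)) (T a) (isClosed_coe_centralizer_singleton a) ν :=
  (hm'.transport_of_pullback ψ hψ hψs hP ν' ν hν T hcoh).atPoint_eq_quotientMeasure_of_forall_map_conj_eq hP hcoh a ha

end TransportPullback

end Literature.NumberTheory.Automorphic

end
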